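import Summits.BirchSwinnertonDyer.BirchSwinnertonDyer.Theorems.ByReductionTypeAtTwoSupersingularFlatLevelSocket
import Summits.BirchSwinnertonDyer.BirchSwinnertonDyer.Theorems.ByReductionTypeAtTwoSupersingularFlatLevelCongruenceLower
import HarnessLib

/-!
# Crux `SupersingularRankZeroAtTwo` (K4, item stmt-BirchSwinnertonDyer-19097), line `odd_blind_package` v2.19, `stub_flatPackage`
# conjunct (8), F3 — FILE E5: ALL LEVELS AT ONCE for THE Sprung–Honda system over its carrier — the (C6)-values and Kato's value law,
# displayed PER LEVEL, give the VALUE identities and the `Λ`-congruences «`ν·P_{n,c_n}(w) ≡ μ·θ_n`», «`ν·P_{m+1,c_m}(w) ≡ μ·Φ·θ_m`» for every `n`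

Seat `bsd-2adic-tower-1` GEN 69, hand «hF3-ERL» (pen GEN 41 SUMMON 20260831T215831Z §1 E3: «state E3 over DISPLAYED `(hV : values)`
binders exactly like K3's sockets»). HONEST FRAMING: theorems only (no definition, no named fact, no instance, no `sorry`); the published
inputs stay DISPLAYED (per-level (C6) pairing-value shape `hV`, Kato's value law `hB2`, the trivial-character value `hB4c`, the cusp
multiplier `hμt`); helper toward conjunct (8) F3 of `stub_flatPackage`; closes no stub and no item; 19097 OPEN; BSD₂ is proved for no
supersingular curve and BSD for no curve by any of this.

## What

★★ `flat_levelCongruences_of_C6` — for the displayed Sprung–Honda data on the `2`-adic model (E0/E0b), its transport `c n` to a field `E/ℚ` (for (8): `E = ℚ_v`, `ιE = closureEmb`)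
(`Φ(g₀ʲ • d₀ n) = gʲ • c n`, `c n ∈ E(K_n·E)`, the `a`-trace relation of `IsHondaSystemAtTwo`), a subgroup `A ∋ gʲ c n` with a functional
`w : A →+ ℤ₂`, a rational newform `f` of odd level with `a₂(f) = a`, odd `c_K, d_K`, a local variable `g₀` (`g₀ʲ ζ_{2^m} = ζ^{5ʲ}` for all `m`),
and PER LEVEL `n`: Kato's embedding `e_n`, a Galois family `τ_n`, an element `x_n` with the (C6) shape
`ι(w(gʲ c n)) = ∑_b τ_n b • (Λ(T⁻¹(g₀ʲ d₀ n)) · e_n x_n)`, Kato's value law `hB2 n`, the trivial value `hB4c` (`n ≤ 1`), and a cusp multiplier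
`μ̃` with `μ̃(χ(5)−1) = D·R(χ)` at every level: then for EVERY `n` (with `ν := C(D·q.den)`, `μ := C(N·q.num)·μ̃`)
(1) `ν(z)·P_{n,c_n}(w)(z) = μ(z)·θ_n(z)` for all `(1+z)^{2ⁿ} = 1`; (2) `∃ m q, C(2^m)(ι μ·θ_n − ι(ν·P_{n,c_n}(w))) = ι(ω_n q)`;
(3) `∃ k q, C(2^k)(ι μ·(Φ_{2^{n+1}}(1+T)·θ_n) − ι(ν·P_{n+1,c_n}(w))) = ι(ω_{n+1} q)` — by E4 (`flat_charValue_of_C6`) at every level,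
E2b/E3 (`forall_char_of_evalOn_of_primitive_or_le_one`, `forall_root_value_eq_of_forall_char`, `exists_C_pow_mul_sub_eq_omega_mul_of_forall_root`)
and E3b. The remaining displayed inputs are exactly K3's CORE_KBK ((KZ)/(C6) + ZetaBody) plus the cusp brick.

References: [Kato2004Asterisque] Thm. 12.5 (1), Thm. 6.6 (1), Thm. 9.7; [Kobayashi2003] (8.23), Prop. 8.25–8.26, proof of Thm. 6.3; [Sprung2012]
Thm. 2.2, Def. 3.1, Props. 6.3–6.5; [MazurTateTeitelbaum1986Invent] §I.10 (10.2), §I.13; [Pollack2003] Prop. 6.18.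
-/

set_option autoImplicit false
-- the Theorems namespace of this sub repeats the summit name by design (D-0017 nested layout)
set_option linter.dupNamespace false

noncomputable section

set_option backward.isDefEq.respectTransparency false

open scoped Classical MatrixGroups ModularForm NumberField

namespace Summit.BirchSwinnertonDyer.BirchSwinnertonDyer.Theorems.SSFlatERL

open CongruenceSubgroup WeierstrassCurve Field IsDedekindDomain NumberField Polynomial
  Literature.NumberTheory.GaloisRepresentations
  Literature.NumberTheory.EllipticCurves Literature.NumberTheory.EllipticCurves.ModularForms
  Literature.NumberTheory.EllipticCurves.Rank1Residual
  Literature.NumberTheory.EllipticCurves.Kobayashi2003 Literature.NumberTheory.EllipticCurves.Kato2004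
  Literature.NumberTheory.EllipticCurves.Kato2004.EulerSystemValues Literature.NumberTheory.EllipticCurves.Sprung2012
  Literature.NumberTheory.EllipticCurves.FormalGroupChart
  ZpExtension
  Summit.BirchSwinnertonDyer.Rank1Residual.Additive Summit.BirchSwinnertonDyer.Rank1Residual.Additive.PadicCyclotomicTower
  Summit.BirchSwinnertonDyer.Rank1Residual.Additive.BallEval
  Summit.BirchSwinnertonDyer.BirchSwinnertonDyer.Theorems.SignedKatoOffTwo.LocalTwo
  Summit.BirchSwinnertonDyer.BirchSwinnertonDyer.Theorems.SignedKatoOffTwo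
  Summit.BirchSwinnertonDyer.BirchSwinnertonDyer.Theorems.SignedKatoOffTwo.CoreChi
  Summit.BirchSwinnertonDyer.BirchSwinnertonDyer.Theorems.SignedKatoOffTwo.KatoBK

/-- **All levels at once for THE Sprung–Honda system** (see the module docstring): from the displayed model data, the transport to the
carrier, the per-level (C6) pairing-value shape, Kato's value law, the trivial-character value and the cusp multiplier, the VALUE identity,
the `Λ`-congruence for `P_{n,c_n}(w)` and the companion congruence for `P_{n+1,c_n}(w)`, at every level `n`.
[cite: Kato2004Asterisque, Thm. 12.5 (1)] [cite: Kobayashi2003, Prop. 8.25–8.26, proof of Thm. 6.3 (p. 25)] [cite: Sprung2012, Props. 6.3–6.5]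
[cite: Pollack2003, Prop. 6.18] -/
theorem flat_levelCongruences_of_C6 (W : WeierstrassCurve ℚ) [W.IsElliptic] [W.IsGloballyMinimal]
    {κ : ZpExtension ℚ 2} (hκ : κ.IsCyclotomic) (ι : AlgebraicClosure ℚ →ₐ[ℚ] AlgebraicClosure ℚ_[2])
    -- the displayed Sprung–Honda data on the `2`-adic model (FILE E0/E0b)
    {x : ℕ → ℚ_[2]} {y : ℕ → localPoints W ℚ_[2]} {σ : ℕ → Field.absoluteGaloisGroup ℚ_[2]} {d₀ : ℕ → localPoints W ℚ_[2]}
    {N : ℕ} {a : ℤ} (hx0 : x 0 = 1) (hx1 : (2 : ℚ_[2]) * x 1 = a) (hx2 : (2 : ℚ_[2]) * x 2 = a * x 1 - x 0) (hN : (N : ℤ) = 3 - a)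
    (hyΩ : haveI := isIntegral_genFib_baseChange 2 ((integralModelInt W).map (Int.castRingHom ℤ_[2]))
        ∀ m, (toLoc ((genFibΩ_eq_baseChange ((integralModelInt W).map (Int.castRingHom ℤ_[2]))).trans
              (baseChange_twoAdicModel W))).symm (y m) ∈
            subfieldPoints (genFibΩ 2 ((integralModelInt W).map (Int.castRingHom ℤ_[2]))) (layer 2 m).toSubfield
              coeffs_mem_layer ∧
          (toLoc ((genFibΩ_eq_baseChange ((integralModelInt W).map (Int.castRingHom ℤ_[2]))).trans
              (baseChange_twoAdicModel W))).symm (y m) ∈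
            kernel (Valued.v (R := PadicAlgCl 2)) (genFibΩ 2 ((integralModelInt W).map (Int.castRingHom ℤ_[2]))) ∧
          ptLogΩ 2 ((integralModelInt W).map (Int.castRingHom ℤ_[2]))
            ((toLoc ((genFibΩ_eq_baseChange ((integralModelInt W).map (Int.castRingHom ℤ_[2]))).trans
              (baseChange_twoAdicModel W))).symm (y m)) =
            ∑ k ∈ Finset.range m, algebraMap ℚ_[2] (PadicAlgCl 2) (x k) * (zeta 2 (m - k) - 1))
    (hystab : ∀ m, ∀ τ ∈ stab 2 m, τ • y m = y m)
    (hσ : ∀ m, 1 ≤ m → σ m • zeta 2 m = (zeta 2 m)⁻¹)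
    (hd₀ : ∀ n, d₀ n = N • (y (n + 2) + σ (n + 2) • y (n + 2)) - 2 • y 1)
    (hL₀ : ∀ m, d₀ m ∈ localLayerPointsOfEmb κ ι W m)
    -- the local variable on the model
    {g₀ : Field.absoluteGaloisGroup ℚ_[2]} (hg₀ : ∀ m j : ℕ, g₀ ^ j • zeta 2 m = zeta 2 m ^ 5 ^ j)
    -- the carrier of (8): a field `E/K`, the transported points `c n` and their `g`-orbits, the functional `w`
    {E : Type} [Field E] [Algebra ℚ E] (ιE : AlgebraicClosure ℚ →ₐ[ℚ] AlgebraicClosure E)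
    {g : Field.absoluteGaloisGroup E} (hg : κ.IsTopGenerator (resGalOfEmb ιE g))
    {c : ℕ → localPoints W E} (hcL : ∀ m, c m ∈ localLayerPointsOfEmb κ ιE W m)
    (hTR : ∀ n, localTraceOfEmb κ ιE W (n + 1) (n + 2) (c (n + 2)) = a • c (n + 1) - c n)
    (A : AddSubgroup (localPoints W E)) (hA : ∀ n j : ℕ, g ^ j • c n ∈ A) (w : A →+ ℤ_[2])
    -- per level: Kato's embedding, the Galois family, Kato's element, the (C6) shape of the pairing values
    (e : ∀ n : ℕ, CyclotomicField (2 ^ (n + 2)) ℚ →ₐ[ℚ] PadicAlgCl 2)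
    (he : ∀ n, e n (IsCyclotomicExtension.zeta (2 ^ (n + 2)) ℚ (CyclotomicField (2 ^ (n + 2)) ℚ)) = zeta 2 (n + 2))
    (τ : ∀ n : ℕ, ZMod (2 ^ (n + 2)) → Field.absoluteGaloisGroup ℚ_[2])
    (hτ : ∀ (n : ℕ) (b : ZMod (2 ^ (n + 2))), IsUnit b → τ n b • zeta 2 (n + 2) = zeta 2 (n + 2) ^ b.val)
    (xF : ∀ n : ℕ, CyclotomicField (2 ^ (n + 2)) ℚ)
    (hV : haveI := isIntegral_genFib_baseChange 2 ((integralModelInt W).map (Int.castRingHom ℤ_[2]))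
      ∀ n j : ℕ, algebraMap ℚ_[2] (PadicAlgCl 2) (evalOn W A w (g ^ j • c n) : ℚ_[2]) =
        ∑ b : (ZMod (2 ^ (n + 2)))ˣ, τ n (b : ZMod (2 ^ (n + 2))) •
          (ptLogΩ 2 ((integralModelInt W).map (Int.castRingHom ℤ_[2]))
            ((toLoc ((genFibΩ_eq_baseChange ((integralModelInt W).map (Int.castRingHom ℤ_[2]))).trans
              (baseChange_twoAdicModel W))).symm (g₀ ^ j • d₀ n)) * e n (xF n)))
    -- the newform, Kato's value law per level, the trivial-character value, the cusp multiplier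
    {M : ℕ} [NeZero M] (f : CuspForm (Gamma0 M) 2) (hf0 : IsNewform0 f) (hQ : coeffField f = ⊥) (h2M : ¬ 2 ∣ M)
    (ha : cuspCoeff f 2 = (a : ℂ)) (q : ℚ) {cK dK : ℤ} (hcK : ¬ (2 : ℤ) ∣ cK) (hdK : ¬ (2 : ℤ) ∣ dK) (S₁ S₂ S₃ S₄ : ℚ)
    (hB2 : ∀ (n : ℕ) (ψF : DirichletCharacter (CyclotomicField (2 ^ (n + 2)) ℚ) (2 ^ (n + 2))), ψF (-1) = 1 → ψF.IsPrimitive →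
      (∑ b : (ZMod (2 ^ (n + 2)))ˣ, ψF⁻¹ (b : ZMod (2 ^ (n + 2))) * sigma (2 ^ (n + 2)) b (xF n)) *
          gaussSum ψF (AddChar.zmodChar (2 ^ (n + 2))
            (IsCyclotomicExtension.zeta_pow (2 ^ (n + 2)) ℚ (CyclotomicField (2 ^ (n + 2)) ℚ))) =
        (q : CyclotomicField (2 ^ (n + 2)) ℚ) * ratTwistedSymbolSum f ψF *
          ((cK : CyclotomicField (2 ^ (n + 2)) ℚ) ^ 2 * (dK : CyclotomicField (2 ^ (n + 2)) ℚ) ^ 2 *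
              (S₁ : CyclotomicField (2 ^ (n + 2)) ℚ)
            - (cK : CyclotomicField (2 ^ (n + 2)) ℚ) * (dK : CyclotomicField (2 ^ (n + 2)) ℚ) ^ 2 * ψF (cK : ZMod (2 ^ (n + 2))) *
              (S₂ : CyclotomicField (2 ^ (n + 2)) ℚ)
            - (cK : CyclotomicField (2 ^ (n + 2)) ℚ) ^ 2 * (dK : CyclotomicField (2 ^ (n + 2)) ℚ) * ψF (dK : ZMod (2 ^ (n + 2))) *
              (S₃ : CyclotomicField (2 ^ (n + 2)) ℚ)
            + (cK : CyclotomicField (2 ^ (n + 2)) ℚ) * (dK : CyclotomicField (2 ^ (n + 2)) ℚ) *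
              (ψF (cK : ZMod (2 ^ (n + 2))) * ψF (dK : ZMod (2 ^ (n + 2)))) * (S₄ : CyclotomicField (2 ^ (n + 2)) ℚ)))
    (hB4c : ∀ n : ℕ, n ≤ 1 → ∑ b : (ZMod (2 ^ (n + 2)))ˣ, sigma (2 ^ (n + 2)) b (xF n) =
      (((3 - (a : ℚ)) / 2 * q * ratPlusSymbol f 0 * (cK ^ 2 * dK ^ 2 * S₁ - cK * dK ^ 2 * S₂ - cK ^ 2 * dK * S₃ + cK * dK * S₄) : ℚ) :
        CyclotomicField (2 ^ (n + 2)) ℚ))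
    (D : ℤ) (μt : IwasawaAlgebra 2)
    (hμt : ∀ (n : ℕ) (χ : DirichletCharacter ℂ_[2] (2 ^ (n + 2))), χ.Even → (∃ j : ℕ, orderOf χ = 2 ^ j) →
      HasSum (fun k ↦ ((algebraMap ℚ_[2] ℂ_[2]).comp (algebraMap ℤ_[2] ℚ_[2])) (PowerSeries.coeff k μt) *
          (χ (5 : ZMod (2 ^ (n + 2))) - 1) ^ k)
        ((D : ℂ_[2]) * ((cK : ℂ_[2]) ^ 2 * (dK : ℂ_[2]) ^ 2 * (S₁ : ℂ_[2]) - (cK : ℂ_[2]) * (dK : ℂ_[2]) ^ 2 * χ (cK : ZMod (2 ^ (n + 2))) * (S₂ : ℂ_[2])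
          - (cK : ℂ_[2]) ^ 2 * (dK : ℂ_[2]) * χ (dK : ZMod (2 ^ (n + 2))) * (S₃ : ℂ_[2])
          + (cK : ℂ_[2]) * (dK : ℂ_[2]) * (χ (cK : ZMod (2 ^ (n + 2))) * χ (dK : ZMod (2 ^ (n + 2)))) * (S₄ : ℂ_[2]))))
    (n : ℕ) :
    (∀ z : ℂ_[2], (1 + z) ^ 2 ^ n = 1 →
      (∑' k, ((algebraMap ℚ_[2] ℂ_[2]).comp (algebraMap ℤ_[2] ℚ_[2]))
            (PowerSeries.coeff k (PowerSeries.C (((D * q.den : ℤ) : ℤ_[2])))) * z ^ k) *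
        (∑' k, ((algebraMap ℚ_[2] ℂ_[2]).comp (algebraMap ℤ_[2] ℚ_[2]))
            (PowerSeries.coeff k (pairingSum W A g n (c n) w)) * z ^ k) =
      (∑' k, ((algebraMap ℚ_[2] ℂ_[2]).comp (algebraMap ℤ_[2] ℚ_[2]))
            (PowerSeries.coeff k (PowerSeries.C ((((N : ℤ) * q.num : ℤ) : ℤ_[2])) * μt)) * z ^ k) *
        (mazurTateElement f 2 n).eval₂ (algebraMap ℚ ℂ_[2]) z) ∧
    (∃ (m : ℕ) (q' : IwasawaAlgebra 2),
      PowerSeries.C ((2 : ℚ_[2]) ^ m) *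
          (iwasawaToPowerSeries 2 (PowerSeries.C ((((N : ℤ) * q.num : ℤ) : ℤ_[2])) * μt) *
              (((mazurTateElement f 2 n).map (algebraMap ℚ ℚ_[2]) : ℚ_[2][X]) : PowerSeries ℚ_[2]) -
            iwasawaToPowerSeries 2 (PowerSeries.C (((D * q.den : ℤ) : ℤ_[2])) * pairingSum W A g n (c n) w)) =
        iwasawaToPowerSeries 2 (((cyclotomicOmega 2 n).map (Int.castRingHom ℤ_[2]) : PowerSeries ℤ_[2]) * q')) ∧
    (∃ (k : ℕ) (q' : IwasawaAlgebra 2),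
      PowerSeries.C ((2 : ℚ_[2]) ^ k) *
          (iwasawaToPowerSeries 2 (PowerSeries.C ((((N : ℤ) * q.num : ℤ) : ℤ_[2])) * μt) *
              (((((cyclotomic (2 ^ (n + 1)) ℤ).comp (X + 1)).map (Int.castRingHom ℚ) * mazurTateElement f 2 n).map
                  (algebraMap ℚ ℚ_[2]) : ℚ_[2][X]) : PowerSeries ℚ_[2]) -
            iwasawaToPowerSeries 2 (PowerSeries.C (((D * q.den : ℤ) : ℤ_[2])) * pairingSum W A g (n + 1) (c n) w)) =
        iwasawaToPowerSeries 2 (((cyclotomicOmega 2 (n + 1)).map (Int.castRingHom ℤ_[2]) : PowerSeries ℤ_[2]) * q')) := by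
  set ν : IwasawaAlgebra 2 := PowerSeries.C (((D * q.den : ℤ) : ℤ_[2])) with hν
  set μ : IwasawaAlgebra 2 := PowerSeries.C ((((N : ℤ) * q.num : ℤ) : ℤ_[2])) * μt with hμ
  -- Step 1: the per-character identity at the primitive characters / base levels (FILE E4), in CORE tokens
  have hce : cyclotomicExponent 2 = 2 := rfl
  have hcg5 : cyclotomicGenerator 2 = 5 := rfl
  have hprim : ∀ (n : ℕ) (χ : DirichletCharacter ℂ_[2] (2 ^ (n + cyclotomicExponent 2))),
      χ.Even → (∃ j : ℕ, orderOf χ = 2 ^ j) → (χ.IsPrimitive ∨ n ≤ 1) →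
      (∑' k, ((algebraMap ℚ_[2] ℂ_[2]).comp (algebraMap ℤ_[2] ℚ_[2])) (PowerSeries.coeff k ν) *
          (χ (cyclotomicGenerator 2 : ZMod (2 ^ (n + cyclotomicExponent 2))) - 1) ^ k) *
        (∑ j ∈ Finset.range (2 ^ n), ((algebraMap ℚ_[2] ℂ_[2]).comp (algebraMap ℤ_[2] ℚ_[2])) (evalOn W A w (g ^ j • c n)) *
          χ (cyclotomicGenerator 2 : ZMod (2 ^ (n + cyclotomicExponent 2))) ^ j) =
      (∑' k, ((algebraMap ℚ_[2] ℂ_[2]).comp (algebraMap ℤ_[2] ℚ_[2])) (PowerSeries.coeff k μ) *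
          (χ (cyclotomicGenerator 2 : ZMod (2 ^ (n + cyclotomicExponent 2))) - 1) ^ k) *
        ratTwistedSymbolSum f χ := by
    intro n
    rw [hce, hcg5]
    simp only [Nat.cast_ofNat]
    intro χ heven hord hprim'
    exact flat_charValue_of_C6 W hκ ι hx0 hx1 hx2 hN hyΩ hystab hσ hd₀ hL₀ n (hg₀ (n + 2)) (e n) (he n) (τ n) (hτ n)
      (fun j ↦ evalOn W A w (g ^ j • c n)) (xF n) (hV n) f hf0 hQ h2M ha q cK dK
      (isUnit_intCast_zmod_two_pow hcK (n + 2)) (isUnit_intCast_zmod_two_pow hdK (n + 2)) S₁ S₂ S₃ S₄ (hB2 n) (hB4c n) D μt (hμt n)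
      χ heven hord hprim'
  -- Step 2: all characters (FILE E2b/E3)
  have hall := forall_char_of_evalOn_of_primitive_or_le_one κ ιE W hf0 hQ h2M ha hg hcL hTR A hA w μ ν hprim
  -- Step 3: values at every root, and the two congruences
  have hval : ∀ z : ℂ_[2], (1 + z) ^ 2 ^ n = 1 →
      (∑' k, ((algebraMap ℚ_[2] ℂ_[2]).comp (algebraMap ℤ_[2] ℚ_[2])) (PowerSeries.coeff k ν) * z ^ k) *
        (∑' k, ((algebraMap ℚ_[2] ℂ_[2]).comp (algebraMap ℤ_[2] ℚ_[2]))
            (PowerSeries.coeff k (pairingSum W A g n (c n) w)) * z ^ k) =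
      (∑' k, ((algebraMap ℚ_[2] ℂ_[2]).comp (algebraMap ℤ_[2] ℚ_[2])) (PowerSeries.coeff k μ) * z ^ k) *
        (mazurTateElement f 2 n).eval₂ (algebraMap ℚ ℂ_[2]) z :=
    fun z hz ↦ forall_root_value_eq_of_forall_char W g c A w μ ν hall n z hz
  refine ⟨hval, exists_C_pow_mul_sub_eq_omega_mul_of_forall_root W g c A w μ ν n hval,
    exists_C_pow_mul_sub_eq_omega_mul_lower_of_forall_root W g c A w μ ν n ?_⟩
  exact fun z hz ↦ forall_root_lower_value_eq_of_forall_char W κ ιE hg hcL A w μ ν hall n z hz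

end Summit.BirchSwinnertonDyer.BirchSwinnertonDyer.Theorems.SSFlatERL

end
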